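import Literature.AlgebraicGeometry.Frobenioids.PerfectionModelUnits
import Literature.AlgebraicGeometry.Frobenioids.PerfectionGpRoots
import Literature.AlgebraicGeometry.Frobenioids.Prop55Sub
import HarnessLib

/-!
# Frobenioids I, Prop. 5.5 (iv) for `C^pf` of a model Frobenioid, II: the comparison functor
# `C^pf → (model Frobenioid of Φ^pf, B^pf, Div_B^pf)`

Mochizuki, *The geometry of Frobenioids I: the general theory*, Kyushu J. Math. **62** (2008)
293–400, Theorem 5.2 (i) p. 100 and Proposition 5.5 (iv) p. 104: "If `C` is the model Frobenioid
associated to data `Φ, B, Div_B : B → Φ^gp` [cf. Theorem 5.2, (ii)], then there is a natural equivalence of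
categories [compatible with the functors to the respective elementary Frobenioids] between `C^pf` … and the
model Frobenioid associated to the data `Φ^pf, B^pf, B^pf → (Φ^gp)^pf`" — "immediate from the definitions"
[cite: MochizukiFrdI2008, Prop. 5.5 (iv) p.104].

Sub-node FrdI:Prop5.5(iv)/P55-L08, `C^pf` row (slot `FrdI.Prop55Sub.Prop55iv_pf`), SECOND PART: the functor.
On objects `((A_D, α), n) ↦ (A_D, α^{1/n})`, `α^{1/n}` the `n`-th root of the image of `α` in the perfect group
`(Φ^pf(A_D))^gp` (`gpRoot`, `gpToPf`, `PerfectionGpRoots.lean`); on a perfected morphism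
`f ↦ (deg_Fr(f), Base(f), Div^pf(f), u^pf(f))` (Prop. 3.2 (i) operations, `PerfectionOps.lean`, and the unit
component of `PerfectionModelUnits.lean`).  The relation (d) of Thm. 5.2 (i) for the image arrow
(`rel_mapData`) is the `(n·a)`-th ROOT of the identity

  `α^{a·deg θ} · Base(frob_A)^*Div(θ) = Base^*(α'^{b}) · Div_B(u_B(θ))` in `Φ(A_D)^gp` (`rel_gp`),

itself "immediate from the definitions" (the relations (d) of `frob_A`, `θ`, `frob_{A'}`), pushed into
`(Φ^pf(A_D))^gp` where `(n·a)`-th powers are injective; `Div_B^pf ∘ (B → B^pf) = (Φ^gp → (Φ^pf)^gp) ∘ Div_B`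
is the perfected-data hypothesis `IsPerfectedDiv`.  Result: the functor `toModelPf` (`map_id`/`map_comp` =
Remark 1.1.1 for `C^pf` + the unit laws), lying over `D` ON THE NOSE (`toModelPf_baseIso`).
Hypotheses: `hF : IsFrobenioid (toElem Φ B DivB)`, `B` group-like, `IsPerfectedDiv`.
-/

namespace Literature.AlgebraicGeometry.Frobenioids

open CategoryTheory Opposite

universe w v u

/-! ### Two naturalities of `Φ^gp → (Φ^pf)^gp` -/

section Naturality

variable {D : Type u} [Category.{v} D] (Φ B : Dᵒᵖ ⥤ CommMonCat.{w}) (DivB : B ⟶ monoidGp Φ)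

/-- `Φ^gp → (Φ^pf)^gp` commutes with pull-back: `(β^*)^{pf,gp} ∘ ι = ι ∘ (β^*)^{gp}`.
[cite: MochizukiFrdI2008, §0 p.11] -/
theorem pullGp_perfection_gpToPf {X Y : D} (β : X ⟶ Y) (z : Algebra.GrothendieckGroup (Φ.obj (op Y))) :
    pullGp (perfectionFunctor Φ) β (gpToPf (Φ.obj (op Y)) z) = gpToPf (Φ.obj (op X)) (pullGp Φ β z) := by
  change MonGp.map (Perfection.map (Φ.map β.op).hom) (MonGp.map (Perfection.of _) z) =
    MonGp.map (Perfection.of _) (MonGp.map (Φ.map β.op).hom z)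
  rw [← MonoidHom.comp_apply, ← MonGp.map_comp, Perfection.map_comp_of, MonGp.map_comp, MonoidHom.comp_apply]

variable {Φ B DivB} in
/-- The perfected divisor map on the image of `B`: `Div_B^pf(u^{1/1}) = ι(Div_B(u))` — the component form of
`IsPerfectedDiv`. [cite: MochizukiFrdI2008, Prop. 5.5 (iv) p.104] -/
theorem divB_perfection_of {DivBpf : perfectionFunctor B ⟶ monoidGp (perfectionFunctor Φ)}
    (hDiv : IsPerfectedDiv Φ B DivB DivBpf) (X : D) (u : B.obj (op X)) :
    divB (perfectionFunctor Φ) (perfectionFunctor B) DivBpf (op X) (Perfection.of _ u) =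
      gpToPf (Φ.obj (op X)) (divB Φ B DivB (op X) u) :=
  congrArg (fun φ : B.obj (op X) ⟶ (monoidGp (perfectionFunctor Φ)).obj (op X) => φ.hom u)
    (NatTrans.congr_app hDiv (op X))

end Naturality

namespace PreFrobenioid

namespace Perfection

namespace ModelPf

variable {D : Type u} [Category.{v} D] {Φ B : Dᵒᵖ ⥤ CommMonCat.{w}} {DivB : B ⟶ monoidGp Φ}
  {hF : IsFrobenioid (ModelFrobenioid.toElem Φ B DivB)} {X Y Z : Perfection hF}

/-! ### The relation (d) "immediate from the definitions", in `Φ(A_D)^gp` -/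

/-- `Div` of a perfected morphism, typed over the model base object. [cite: MochizukiFrdI2008, Prop. 3.2 (i) p.58] -/
noncomputable abbrev Hom.mdiv (f : X ⟶ Y) : Frobenioids.Perfection (Φ.obj (op X.obj.base)) := Hom.div f

/-- Relation (d) of the chosen Frobenius arrow `frob_A`: `α^a = Base(frob_A)^* ξ · Div_B(u_{frob_A})`
(`Div(frob_A) = 0`). [cite: MochizukiFrdI2008, Thm. 5.2 (i) p.100] -/
theorem cls_pow_eq (A : ModelFrobenioid Φ B DivB) (a : ℕ+) :
    A.cls ^ (a : ℕ) = pullGp Φ (ModelFrobenioid.baseMap (frob hF A a)) (frobPow hF A a).cls *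
      divB Φ B DivB (op A.base) (ModelFrobenioid.unit (frob hF A a)) := by
  have h := ModelFrobenioid.rel (frob hF A a)
  have hd : ModelFrobenioid.degFr (frob hF A a) = a := degFr_frob hF A a
  rw [ModelFrobenioid.div_eq_one_of_isFrobeniusType (isFrobeniusType_frob hF A a), map_one, mul_one, hd] at h
  exact h

/-- **The identity behind Prop. 5.5 (iv) for `C^pf`** ("immediate from the definitions"): for a representative
`θ : A^{(a)} → A'^{(b)}` of a perfected morphism `(A, n) → (A', m)`,
`α^{a·deg θ} · Base(frob_A)^* Div(θ) = Base(r)^* (α'^{b}) · Div_B(u_B(θ))` in `Φ(A_D)^gp` — the relations (d)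
of `frob_A`, `θ`, `frob_{A'}` combined. [cite: MochizukiFrdI2008, Prop. 5.5 (iv) p.104] -/
theorem rel_gp (hB : Objectwise (fun M _ => IsGroupLike M) B) (r : Rep X Y) :
    X.obj.cls ^ ((r.L.a : ℕ) * (ModelFrobenioid.degFr r.hom : ℕ)) *
        Algebra.GrothendieckGroup.of (pull Φ (ModelFrobenioid.baseMap (frob hF X.obj r.L.a)) (ModelFrobenioid.div r.hom)) =
      pullGp Φ (Rep.mbase X Y r) (Y.obj.cls ^ (r.L.b : ℕ)) *
        divB Φ B DivB (op X.obj.base) (unitB hB r) := by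
  -- the three relations (d)
  have hA := cls_pow_eq (hF := hF) X.obj r.L.a
  have hθ := ModelFrobenioid.rel r.hom
  have hA' := cls_pow_eq (hF := hF) Y.obj r.L.b
  -- clear `Div_B(Base(r)^* u_{frob_{A'}})` using `unitB_mul`
  have hu := congrArg (divB Φ B DivB (op X.obj.base)) (unitB_mul hB r)
  rw [map_mul, map_mul, map_pow] at hu
  -- compute
  rw [pow_mul, hA, mul_pow, ← map_pow, ← map_pow, ← pullGp_of', mul_right_comm, ← map_mul, hθ, map_mul,
    ← pullGp_comp, ModelFrobenioid.pullGp_divB_pull, ← mbase_comp, pullGp_comp, hA', map_mul,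
    ModelFrobenioid.pullGp_divB_pull, mul_assoc,
    mul_assoc]
  congr 1
  rw [map_pow, ← hu, mul_comm]

/-! ### Plain-typed forms of the target data (`Φ^pf`, `B^pf`, `Div_B^pf`) -/

/-- `(Φ^pf)^gp`-pull-back along `β`, with the carrier types spelled `Perfection (Φ _)`.
[cite: MochizukiFrdI2008, Def. 1.1 (ii) p.19] -/
noncomputable abbrev pullGpPf {X' Y' : D} (β : X' ⟶ Y') :
    Algebra.GrothendieckGroup (Frobenioids.Perfection (Φ.obj (op Y'))) →*
      Algebra.GrothendieckGroup (Frobenioids.Perfection (Φ.obj (op X'))) :=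
  pullGp (perfectionFunctor Φ) β

/-- `pullGpPf` commutes with `Φ^gp → (Φ^pf)^gp`. [cite: MochizukiFrdI2008, §0 p.11] -/
theorem pullGpPf_gpToPf {X' Y' : D} (β : X' ⟶ Y') (z : Algebra.GrothendieckGroup (Φ.obj (op Y'))) :
    pullGpPf (Φ := Φ) β (gpToPf (Φ.obj (op Y')) z) = gpToPf (Φ.obj (op X')) (pullGp Φ β z) :=
  pullGp_perfection_gpToPf Φ β z

variable (DivBpf : perfectionFunctor B ⟶ monoidGp (perfectionFunctor Φ))

/-- `Div_B^pf` at `A_D`, with the carrier types spelled `Perfection (B A_D) → (Perfection (Φ A_D))^gp`.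
[cite: MochizukiFrdI2008, Prop. 5.5 (iv) p.104] -/
noncomputable abbrev divBpfAt (A : D) :
    Frobenioids.Perfection (B.obj (op A)) →* Algebra.GrothendieckGroup (Frobenioids.Perfection (Φ.obj (op A))) :=
  divB (perfectionFunctor Φ) (perfectionFunctor B) DivBpf (op A)

/-- `Div_B^pf(u^{1/1}) = ι(Div_B(u))` (`IsPerfectedDiv`). [cite: MochizukiFrdI2008, Prop. 5.5 (iv) p.104] -/
theorem divBpfAt_of (hDiv : IsPerfectedDiv Φ B DivB DivBpf) (A : D) (u : B.obj (op A)) :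
    divBpfAt (Φ := Φ) DivBpf A (Frobenioids.Perfection.of _ u) = gpToPf (Φ.obj (op A)) (divB Φ B DivB (op A) u) :=
  divB_perfection_of hDiv A u

/-- `Div_B^pf(u^{1/k})^k = ι(Div_B(u))`. [cite: MochizukiFrdI2008, Prop. 5.5 (iv) p.104] -/
theorem divBpfAt_mk_pow (hDiv : IsPerfectedDiv Φ B DivB DivBpf) (A : D) (u : B.obj (op A)) (k : ℕ+) :
    divBpfAt (Φ := Φ) DivBpf A (Frobenioids.Perfection.mk u k) ^ (k : ℕ) =
      gpToPf (Φ.obj (op A)) (divB Φ B DivB (op A) u) := by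
  rw [← map_pow, Frobenioids.Perfection.mk_pow_self, divBpfAt_of DivBpf hDiv]

/-! ### The object map and the relation (d) of the image arrows -/

/-- The object map `((A_D, α), n) ↦ (A_D, α^{1/n})`, `α^{1/n} := gpRoot n (ι α)` the `n`-th root of the image of
`α` in the perfect group `(Φ^pf(A_D))^gp`. [cite: MochizukiFrdI2008, Prop. 5.5 (iv) p.104] -/
noncomputable abbrev objPf (X : Perfection hF) : ModelFrobenioid (perfectionFunctor Φ) (perfectionFunctor B) DivBpf :=
  ⟨X.obj.base, gpRoot (Φ.obj (op X.obj.base)) X.idx (gpToPf (Φ.obj (op X.obj.base)) X.obj.cls)⟩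

/-- `Div^pf` of a representative, typed in `Φ(A_D)^pf`. [cite: MochizukiFrdI2008, Prop. 3.2 (i) p.58] -/
noncomputable abbrev Rep.pdiv (r : Rep X Y) : Frobenioids.Perfection (Φ.obj (op X.obj.base)) := Rep.div r

/-- `Div^pf` of a representative in model terms: `(Base(frob_A)^* Div(θ))^{1/(n a)}`.
[cite: MochizukiFrdI2008, Prop. 3.2 (i) p.58] -/
theorem Rep.pdiv_eq (r : Rep X Y) :
    Rep.pdiv r = Frobenioids.Perfection.mk
      (pull Φ (ModelFrobenioid.baseMap (frob hF X.obj r.L.a)) (ModelFrobenioid.div r.hom)) (X.idx * r.L.a) := rfl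

/-- `Div^pf` of a perfected morphism, typed in `Φ(A_D)^pf`. [cite: MochizukiFrdI2008, Prop. 3.2 (i) p.58] -/
noncomputable abbrev Hom.pdiv (f : X ⟶ Y) : Frobenioids.Perfection (Φ.obj (op X.obj.base)) := Hom.div f

/-- **Relation (d) for the image of a representative**: the `(n·a)`-th root of `rel_gp`, taken in the perfect
group `(Φ^pf(A_D))^gp`. [cite: MochizukiFrdI2008, Prop. 5.5 (iv) p.104] -/
theorem rel_rep (hB : Objectwise (fun M _ => IsGroupLike M) B) (hDiv : IsPerfectedDiv Φ B DivB DivBpf)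
    (r : Rep X Y) :
    gpRoot (Φ.obj (op X.obj.base)) X.idx (gpToPf _ X.obj.cls) ^ (ModelFrobenioid.degFr r.hom : ℕ) *
        Algebra.GrothendieckGroup.of (Rep.pdiv r) =
      pullGpPf (Φ := Φ) (Rep.mbase X Y r) (gpRoot (Φ.obj (op Y.obj.base)) Y.idx (gpToPf _ Y.obj.cls)) *
        divBpfAt (Φ := Φ) DivBpf X.obj.base (unitPf hB r) := by
  apply ((isPerfect_gpPerfection (Φ.obj (op X.obj.base))).bijective_pow ((X.idx * r.L.a : ℕ+) : ℕ)
    (PNat.pos _)).1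
  dsimp only
  have hexp : (ModelFrobenioid.degFr r.hom : ℕ) * ((X.idx * r.L.a : ℕ+) : ℕ) =
      (X.idx : ℕ) * ((r.L.a : ℕ) * (ModelFrobenioid.degFr r.hom : ℕ)) := by
    rw [PNat.mul_coe]; ring
  rw [mul_pow, mul_pow, ← pow_mul, hexp, pow_mul, gpRoot_pow, ← map_pow, ← map_pow, Rep.pdiv_eq,
    Frobenioids.Perfection.mk_pow_self, ← gpToPf_of, ← map_mul, rel_gp hB r, map_mul]
  unfold unitPf
  rw [divBpfAt_mk_pow DivBpf hDiv, ← map_pow, r.L.eq, PNat.mul_coe, pow_mul, gpRoot_pow, ← map_pow,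
    pullGpPf_gpToPf]

/-- Relation (d) for the image of a perfected morphism. [cite: MochizukiFrdI2008, Prop. 5.5 (iv) p.104] -/
theorem rel_hom (hB : Objectwise (fun M _ => IsGroupLike M) B) (hDiv : IsPerfectedDiv Φ B DivB DivBpf)
    (f : X ⟶ Y) :
    gpRoot (Φ.obj (op X.obj.base)) X.idx (gpToPf _ X.obj.cls) ^ (Hom.degFr f : ℕ) *
        Algebra.GrothendieckGroup.of (Hom.pdiv f) =
      pullGpPf (Φ := Φ) (Hom.mbase f) (gpRoot (Φ.obj (op Y.obj.base)) Y.idx (gpToPf _ Y.obj.cls)) *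
        divBpfAt (Φ := Φ) DivBpf X.obj.base (Hom.unitPf hB f) := by
  obtain ⟨r, rfl⟩ := Hom.mk_surjective f
  exact rel_rep DivBpf hB hDiv r

variable (hB : Objectwise (fun M _ => IsGroupLike M) B) (hDiv : IsPerfectedDiv Φ B DivB DivBpf)

/-- The image of a perfected morphism: `f ↦ (deg_Fr(f), Base(f), Div^pf(f), u^pf(f))`.
[cite: MochizukiFrdI2008, Prop. 5.5 (iv) p.104] -/
noncomputable def mapPf (f : X ⟶ Y) : objPf DivBpf X ⟶ objPf DivBpf Y :=
  ModelFrobenioid.mkHom _ _ (Hom.degFr f) (Hom.mbase f) (Hom.pdiv f) (Hom.unitPf hB f) (rel_hom DivBpf hB hDiv f)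

variable (hF)

/-- **The comparison functor `C^pf → (model Frobenioid of Φ^pf, B^pf, Div_B^pf)`** of Prop. 5.5 (iv).
[cite: MochizukiFrdI2008, Prop. 5.5 (iv) p.104] -/
noncomputable def toModelPf : Perfection hF ⥤ ModelFrobenioid (perfectionFunctor Φ) (perfectionFunctor B) DivBpf where
  obj := objPf DivBpf
  map := mapPf DivBpf hB hDiv
  map_id X := ModelFrobenioid.hom_ext (degFr_id' X) (baseMap_id X) (div_id' X) (unitPf_id hB X)
  map_comp f g := ModelFrobenioid.hom_ext ((degFr_comp' f g).trans (mul_comm _ _)) (baseMap_comp f g)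
    (div_comp' f g) (unitPf_comp hB f g)

/-- Components of the image arrows. [cite: MochizukiFrdI2008, Prop. 5.5 (iv) p.104] -/
@[simp] theorem degFr_map (f : X ⟶ Y) : ModelFrobenioid.degFr ((toModelPf hF DivBpf hB hDiv).map f) = Hom.degFr f := rfl

/-- Components of the image arrows. [cite: MochizukiFrdI2008, Prop. 5.5 (iv) p.104] -/
@[simp] theorem baseMap_map (f : X ⟶ Y) : ModelFrobenioid.baseMap ((toModelPf hF DivBpf hB hDiv).map f) = Hom.mbase f := rfl

/-- Components of the image arrows. [cite: MochizukiFrdI2008, Prop. 5.5 (iv) p.104] -/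
@[simp] theorem div_map (f : X ⟶ Y) : ModelFrobenioid.div ((toModelPf hF DivBpf hB hDiv).map f) = Hom.pdiv f := rfl

/-- Components of the image arrows. [cite: MochizukiFrdI2008, Prop. 5.5 (iv) p.104] -/
@[simp] theorem unit_map (f : X ⟶ Y) : ModelFrobenioid.unit ((toModelPf hF DivBpf hB hDiv).map f) = Hom.unitPf hB f := rfl

/-- The object map, for `simp`. [cite: MochizukiFrdI2008, Prop. 5.5 (iv) p.104] -/
theorem toModelPf_obj (X : Perfection hF) : (toModelPf hF DivBpf hB hDiv).obj X = objPf DivBpf X := rfl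

/-- **Over `D` on the nose**: the comparison functor followed by the projection of the model Frobenioid is the
base functor of `C^pf` ("compatible with the functors to the respective elementary Frobenioids", base part).
[cite: MochizukiFrdI2008, Prop. 5.5 (iv) p.104] -/
noncomputable def toModelPfBaseIso :
    toModelPf hF DivBpf hB hDiv ⋙ ModelFrobenioid.baseFunctor _ _ _ ≅ (ops hF).base :=
  NatIso.ofComponents (fun _ => Iso.refl _) fun f =>
    (Category.comp_id _).trans (Category.id_comp ((ops hF).base.map f)).symm

end ModelPf

end Perfection

end PreFrobenioid

end Literature.AlgebraicGeometry.Frobenioids
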